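import Summits.Parity.GeneralizedHardyLittlewood.Theorems.LeeYangFibresRelativeDimOneSplitDefs
import Summits.Parity.GeneralizedHardyLittlewood.Theorems.LeeYangFibresCellParityLawSingularRatio
import Literature.NumberTheory.Sieve.LinearEquationsInPrimesProofs
import Mathlib.Data.Nat.Squarefree
import HarnessLib

/-!
# Route `LeeYangFibres`, crux `RelativeDimOne` (stmt-Parity-14113), line `gallagher-backwards-split`:
# the Euler expansion of the singular series over incidence types (aux for stub `stub_singularSeriesBandlimited`)

Infrastructure for the registered stub `stub_singularSeriesBandlimited` (and for `stub_cosetSingularMean`):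

* TYPE FACTORISATION (`localFactor_sys_eq_of_incType_eq`, the registered aux theorem). For a prime `p` and a
  `d = 1` system `ψ_i(n) = a_i n + b_i` (`sys a b`), `β_p = (p/(p-1))^t · g_p / p` with
  `g_p = #{v mod p : p ∤ a_i v + b_i ∀ i}` (`localFactor_prime`, `goodCount`). If some form is `≡ 0 (mod p)`
  identically (`p ∣ a_i`, `p ∣ b_i`) then `g_p = 0`; otherwise the bad residues are the roots `-b_i a_i⁻¹` of
  the forms with `p ∤ a_i`, and two roots coincide iff `p ∣ D_ij = a_i b_j - a_j b_i`. All of this is read off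
  the INCIDENCE TYPE `incType p a b = ((gcd(a_i,p), gcd(b_i, gcd(a_i,p)))_i, (gcd(D_ij, p))_{ij})`, so
  `β_p(sys a b) = β_p(sys a b')` whenever `incType p a b = incType p a b'` (two root maps with the same
  coincidence relation have images of the same size, `card_image_eq_of_iff`). Moreover `incType q` determines
  `incType p` for `p ∣ q` (`incType_eq_of_dvd`).
* THE SPECTRUM (`exists_singSpec`): some `g` has `g(q, a, incType_q(a,b)) = μ²(q) ∏_{p ∣ q} (β_p(sys a b) - 1)`
  for all `q, a, b` (choice of a `b` per type; well defined by the factorisation), and then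
  `bandSum Q g a b = Σ_{q ≤ Q, q squarefree} ∏_{p ∣ q} (β_p(sys a b) - 1)` (`bandSum_eq_sum_squarefree`).
* EULER EXPANSION (`singularProductPartial_eq_sum_powerset`, `sum_squarefree_Icc_eq_sum_powerset`,
  `singularProductPartial_sub_sum_squarefree`): `∏_{p ≤ x} β_p = Σ_{U ⊆ primes ≤ x} ∏_{p ∈ U} (β_p - 1)`
  (`Finset.prod_one_add`), squarefree `q ≤ Q ≤ x` ↔ `U` with `∏ U ≤ Q`, so
  `∏_{p ≤ x} β_p - Σ_{q ≤ Q sqfree} ∏_{p ∣ q}(β_p - 1) = Σ_{U ⊆ primes ≤ x, ∏U > Q} ∏_{p ∈ U} (β_p - 1)`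
  — the tail that `…SplitBandlimited` bounds by Rankin's trick.

References: Green–Tao, Ann. of Math. 171 (2010), Lemma 1.3, (1.6) [GreenTao2010]; Gallagher, Mathematika 23
(1976), §2 [Gallagher1976].
-/

noncomputable section

open scoped BigOperators Topology
open Finset Filter Literature.NumberTheory.Sieve
open Summit.Parity.GeneralizedHardyLittlewood.Cruxes.CellParityLaw.SectionAnnihilator (SingularRatio.modEval_one)

namespace Summit.Parity.GeneralizedHardyLittlewood.Cruxes.RelativeDimOne.GallagherBackwardsSplit

variable {t : ℕ}

namespace EulerExpansion

/-! ## Arithmetic of incidence types -/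

/-- For `p ∣ q`: `gcd(x, p) = gcd(gcd(x, q), p)`. [folklore] -/
theorem int_gcd_eq_gcd_gcd {p q : ℕ} (hpq : p ∣ q) (x : ℤ) : Int.gcd x p = Nat.gcd (Int.gcd x q) p := by
  rw [Int.gcd_eq_natAbs, Int.gcd_eq_natAbs, Int.natAbs_natCast, Int.natAbs_natCast, Nat.gcd_assoc,
    Nat.gcd_eq_right hpq]

/-- `gcd(x, p) = p` iff `x ≡ 0 (mod p)`. [folklore] -/
theorem int_gcd_eq_self_iff {p : ℕ} (x : ℤ) : Int.gcd x p = p ↔ (x : ZMod p) = 0 := by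
  rw [ZMod.intCast_zmod_eq_zero_iff_dvd, Int.natCast_dvd, Int.gcd_eq_natAbs, Int.natAbs_natCast]
  exact ⟨fun h => h ▸ Nat.gcd_dvd_left _ _, fun h => Nat.gcd_eq_right h⟩

/-- The incidence type mod `q` determines the incidence type mod every `p ∣ q`. [folklore] -/
theorem incType_eq_of_dvd {p q : ℕ} (hpq : p ∣ q) {a b b' : Fin t → ℤ} (h : incType q a b = incType q a b') :
    incType p a b = incType p a b' := by
  have h1 : ∀ i, Int.gcd (b i) (Int.gcd (a i) q) = Int.gcd (b' i) (Int.gcd (a i) q) := fun i =>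
    congr_arg Prod.snd (congr_fun (congr_arg Prod.fst h) i)
  have h2 : ∀ i j, Int.gcd (a i * b j - a j * b i) q = Int.gcd (a i * b' j - a j * b' i) q := fun i j =>
    congr_fun (congr_fun (congr_arg Prod.snd h) i) j
  refine Prod.ext (funext fun i => Prod.ext rfl ?_) (funext fun i => funext fun j => ?_)
  · show Int.gcd (b i) (Int.gcd (a i) p) = Int.gcd (b' i) (Int.gcd (a i) p)
    have hd : Int.gcd (a i) p ∣ Int.gcd (a i) q := by
      rw [int_gcd_eq_gcd_gcd hpq]
      exact Nat.gcd_dvd_left _ _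
    rw [int_gcd_eq_gcd_gcd hd, int_gcd_eq_gcd_gcd hd (b' i), h1 i]
  · show Int.gcd (a i * b j - a j * b i) p = Int.gcd (a i * b' j - a j * b' i) p
    rw [int_gcd_eq_gcd_gcd hpq, int_gcd_eq_gcd_gcd hpq (a i * b' j - a j * b' i), h2 i j]

/-! ## Type factorisation of the local factors at a prime -/

/-- The forms of `sys a b` reduced mod `p`: `ψ_i(v) = a_i v + b_i`. [folklore] -/
theorem modEval_sys (a b : Fin t → ℤ) (i : Fin t) (p : ℕ) (v : Fin 1 → ZMod p) :
    (sys a b i).modEval p v = (a i : ZMod p) * v 0 + (b i : ZMod p) :=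
  SingularRatio.modEval_one _ p v

/-- Two maps with the same coincidence relation on `s` have images of the same size. [folklore] -/
theorem card_image_eq_of_iff {α β γ : Type*} [DecidableEq β] [DecidableEq γ] (s : Finset α) (f : α → β)
    (g : α → γ) (h : ∀ i ∈ s, ∀ j ∈ s, (f i = f j ↔ g i = g j)) : #(s.image f) = #(s.image g) := by
  refine Finset.card_bij (fun y hy => g (Classical.choose (Finset.mem_image.mp hy))) ?_ ?_ ?_
  · intro y hy
    obtain ⟨hx, -⟩ := Classical.choose_spec (Finset.mem_image.mp hy)
    exact Finset.mem_image_of_mem g hx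
  · intro y₁ hy₁ y₂ hy₂ heq
    obtain ⟨hx₁, e₁⟩ := Classical.choose_spec (Finset.mem_image.mp hy₁)
    obtain ⟨hx₂, e₂⟩ := Classical.choose_spec (Finset.mem_image.mp hy₂)
    rw [← e₁, ← e₂]
    exact (h _ hx₁ _ hx₂).mpr heq
  · intro z hz
    obtain ⟨x, hx, rfl⟩ := Finset.mem_image.mp hz
    refine ⟨f x, Finset.mem_image_of_mem f hx, ?_⟩
    obtain ⟨hx', e'⟩ := Classical.choose_spec (Finset.mem_image.mp (Finset.mem_image_of_mem f hx))
    exact (h _ hx' _ hx).mp e'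

variable {p : ℕ} [hp : Fact p.Prime]

/-- If no form of `sys a b` vanishes identically mod `p`, the good residues are exactly the non-roots
`v ≠ -b_i a_i⁻¹` of the forms with `p ∤ a_i`: `g_p = p - #{roots}`. [cite: GreenTao2010, proof of Lemma 1.3] -/
theorem goodCount_sys_eq_card (a b : Fin t → ℤ) (hA : ∀ i, (a i : ZMod p) = 0 → (b i : ZMod p) ≠ 0) :
    goodCount (sys a b) p =
      Fintype.card (Fin 1 → ZMod p) -
        #((univ.filter fun i => (a i : ZMod p) ≠ 0).image fun i (_ : Fin 1) => -(b i : ZMod p) * ((a i : ZMod p))⁻¹) := by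
  rw [← Finset.card_univ_sdiff]
  unfold goodCount
  congr 1
  ext v
  simp only [Finset.mem_filter, Finset.mem_univ, true_and, Finset.mem_sdiff, Finset.mem_image, not_exists,
    not_and]
  constructor
  · intro hv i hai heq
    apply hv i
    rw [modEval_sys, ← heq]
    show (a i : ZMod p) * (-(b i : ZMod p) * ((a i : ZMod p))⁻¹) + (b i : ZMod p) = 0
    have hii : (a i : ZMod p) * ((a i : ZMod p))⁻¹ = 1 := mul_inv_cancel₀ hai
    linear_combination (-(b i : ZMod p)) * hii
  · intro hv i hzero
    rw [modEval_sys] at hzero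
    by_cases hai : (a i : ZMod p) = 0
    · rw [hai, zero_mul, zero_add] at hzero
      exact hA i hai hzero
    · refine hv i hai (funext fun k => ?_)
      rw [Fin.fin_one_eq_zero k]
      show -(b i : ZMod p) * ((a i : ZMod p))⁻¹ = v 0
      have hii : (a i : ZMod p) * ((a i : ZMod p))⁻¹ = 1 := mul_inv_cancel₀ hai
      linear_combination (-((a i : ZMod p))⁻¹) * hzero + (v 0) * hii

/-- Roots of two forms with `p ∤ a_i, a_j` coincide iff `p ∣ D_ij = a_i b_j - a_j b_i`.
[cite: GreenTao2010, proof of Lemma 1.3] -/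
theorem root_eq_iff (a b : Fin t → ℤ) {i j : Fin t} (hai : (a i : ZMod p) ≠ 0) (haj : (a j : ZMod p) ≠ 0) :
    (fun _ : Fin 1 => -(b i : ZMod p) * ((a i : ZMod p))⁻¹) = (fun _ : Fin 1 => -(b j : ZMod p) * ((a j : ZMod p))⁻¹) ↔
      ((a i * b j - a j * b i : ℤ) : ZMod p) = 0 := by
  have hi : (a i : ZMod p) * ((a i : ZMod p))⁻¹ = 1 := mul_inv_cancel₀ hai
  have hj : (a j : ZMod p) * ((a j : ZMod p))⁻¹ = 1 := mul_inv_cancel₀ haj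
  push_cast
  constructor
  · intro h
    have h0 : -(b i : ZMod p) * ((a i : ZMod p))⁻¹ = -(b j : ZMod p) * ((a j : ZMod p))⁻¹ := congr_fun h 0
    linear_combination ((a i : ZMod p) * (a j : ZMod p)) * h0 + (-((a i : ZMod p) * (b j : ZMod p))) * hj +
      ((a j : ZMod p) * (b i : ZMod p)) * hi
  · intro h
    funext k
    show -(b i : ZMod p) * ((a i : ZMod p))⁻¹ = -(b j : ZMod p) * ((a j : ZMod p))⁻¹
    linear_combination (((a i : ZMod p))⁻¹ * ((a j : ZMod p))⁻¹) * h +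
      (-(b j : ZMod p) * ((a j : ZMod p))⁻¹) * hi + ((b i : ZMod p) * ((a i : ZMod p))⁻¹) * hj

/-- TYPE FACTORISATION at the level of counts: `g_p(sys a b) = g_p(sys a b')` whenever
`incType p a b = incType p a b'`. [cite: GreenTao2010, proof of Lemma 1.3] -/
theorem goodCount_sys_eq_of_incType_eq (a b b' : Fin t → ℤ) (h : incType p a b = incType p a b') :
    goodCount (sys a b) p = goodCount (sys a b') p := by
  have h1 : ∀ i, Int.gcd (b i) (Int.gcd (a i) p) = Int.gcd (b' i) (Int.gcd (a i) p) := fun i =>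
    congr_arg Prod.snd (congr_fun (congr_arg Prod.fst h) i)
  have h2 : ∀ i j, Int.gcd (a i * b j - a j * b i) p = Int.gcd (a i * b' j - a j * b' i) p := fun i j =>
    congr_fun (congr_fun (congr_arg Prod.snd h) i) j
  have hb0 : ∀ i, (a i : ZMod p) = 0 → ((b i : ZMod p) = 0 ↔ (b' i : ZMod p) = 0) := by
    intro i hai
    have hg : Int.gcd (a i) p = p := (int_gcd_eq_self_iff (a i)).mpr hai
    have := h1 i
    rw [hg] at this
    rw [← int_gcd_eq_self_iff, ← int_gcd_eq_self_iff, this]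
  have hD : ∀ i j, ((a i * b j - a j * b i : ℤ) : ZMod p) = 0 ↔ ((a i * b' j - a j * b' i : ℤ) : ZMod p) = 0 := by
    intro i j
    rw [← int_gcd_eq_self_iff, ← int_gcd_eq_self_iff, h2 i j]
  by_cases hA : ∃ i, (a i : ZMod p) = 0 ∧ (b i : ZMod p) = 0
  · obtain ⟨i, hai, hbi⟩ := hA
    have hbi' : (b' i : ZMod p) = 0 := (hb0 i hai).mp hbi
    have e : ∀ c : Fin t → ℤ, (c i : ZMod p) = 0 → goodCount (sys a c) p = 0 := by
      intro c hci
      unfold goodCount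
      rw [Finset.card_eq_zero, Finset.filter_eq_empty_iff]
      intro v _ hv
      exact hv i (by rw [modEval_sys, hai, hci, zero_mul, zero_add])
    rw [e b hbi, e b' hbi']
  · push Not at hA
    have hA' : ∀ i, (a i : ZMod p) = 0 → (b' i : ZMod p) ≠ 0 := fun i hai hbi' =>
      hA i hai ((hb0 i hai).mpr hbi')
    rw [goodCount_sys_eq_card a b hA, goodCount_sys_eq_card a b' hA']
    congr 1
    refine card_image_eq_of_iff _ _ _ fun i hi j hj => ?_
    rw [Finset.mem_filter] at hi hj
    rw [root_eq_iff a b hi.2 hj.2, root_eq_iff a b' hi.2 hj.2]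
    exact hD i j

end EulerExpansion

open EulerExpansion

/-- **TYPE FACTORISATION** (registered aux theorem for `stub_singularSeriesBandlimited`): at a prime `p`, the
local factor `β_p` of a `d = 1` system `ψ_i(n) = a_i n + b_i` depends on the shifts `b` only through the incidence
type `incType p a b` (which `p ∣ a_i`, which `p ∣ b_i` among those, which `p ∣ a_i b_j - a_j b_i`).
[cite: GreenTao2010, proof of Lemma 1.3] -/
theorem localFactor_sys_eq_of_incType_eq : ∀ {t : ℕ} (p : ℕ), p.Prime → ∀ a b b' : Fin t → ℤ, incType p a b = incType p a b' → localFactor (sys a b) p = localFactor (sys a b') p := by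
  intro t p hp a b b' h
  haveI := Fact.mk hp
  rw [localFactor_prime, localFactor_prime, goodCount_sys_eq_of_incType_eq a b b' h]

namespace EulerExpansion

/-! ## The singular-series incidence spectrum -/

/-- **THE SINGULAR-SERIES SPECTRUM EXISTS**: there is an incidence spectrum `g` with
`g(q, a, incType_q(a, b)) = μ²(q) ∏_{p ∣ q} (β_p(sys a b) - 1)` for ALL `q, a, b` (take, for a type `τ` mod a
squarefree `q`, the product for any `b` of type `τ` — well defined by the type factorisation and
`incType_eq_of_dvd`; `0` off the squarefree moduli). [cite: Gallagher1976, Section 2] -/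
theorem exists_singSpec (t : ℕ) : ∃ g : ℕ → (Fin t → ℤ) → IncType t → ℝ, ∀ (q : ℕ) (a b : Fin t → ℤ),
    g q a (incType q a b) = if Squarefree q then ∏ p ∈ q.primeFactors, (localFactor (sys a b) p - 1) else 0 := by
  classical
  refine ⟨fun q a τ => if h : Squarefree q ∧ ∃ b : Fin t → ℤ, incType q a b = τ then
    ∏ p ∈ q.primeFactors, (localFactor (sys a h.2.choose) p - 1) else 0, fun q a b => ?_⟩
  beta_reduce
  by_cases hq : Squarefree q
  · have h : Squarefree q ∧ ∃ b₁ : Fin t → ℤ, incType q a b₁ = incType q a b := ⟨hq, b, rfl⟩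
    rw [dif_pos h, if_pos hq]
    refine Finset.prod_congr rfl fun p hp => ?_
    rw [localFactor_sys_eq_of_incType_eq p (Nat.prime_of_mem_primeFactors hp) a _ b
      (incType_eq_of_dvd (Nat.dvd_of_mem_primeFactors hp) h.2.choose_spec)]
  · rw [dif_neg fun h => hq h.1, if_neg hq]

/-- The band sum of (any realisation of) the singular-series spectrum is the truncated squarefree expansion
`Σ_{q ≤ Q, q sqfree} ∏_{p ∣ q} (β_p(sys a b) - 1)`. [cite: Gallagher1976, Section 2] -/
theorem bandSum_eq_sum_squarefree {g : ℕ → (Fin t → ℤ) → IncType t → ℝ}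
    (hg : ∀ (q : ℕ) (a b : Fin t → ℤ),
      g q a (incType q a b) = if Squarefree q then ∏ p ∈ q.primeFactors, (localFactor (sys a b) p - 1) else 0)
    (Q : ℕ) (a b : Fin t → ℤ) :
    bandSum Q g a b = ∑ q ∈ (Finset.Icc 1 Q).filter Squarefree, ∏ p ∈ q.primeFactors, (localFactor (sys a b) p - 1) := by
  rw [bandSum, Finset.sum_filter]
  exact Finset.sum_congr rfl fun q _ => hg q a b

/-! ## The Euler expansion of the partial singular products -/

/-- `∏_{p ≤ x} β_p = Σ_{U ⊆ {p ≤ x}} ∏_{p ∈ U} (β_p - 1)`. [folklore] -/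
theorem singularProductPartial_eq_sum_powerset {d s : ℕ} (Ψ : Fin s → AffLinForm d) (x : ℕ) :
    singularProductPartial Ψ x = ∑ U ∈ (Nat.primesLE x).powerset, ∏ p ∈ U, (localFactor Ψ p - 1) := by
  rw [← Finset.prod_one_add]
  exact Finset.prod_congr rfl fun p _ => by ring

/-- Squarefree `q ≤ Q` correspond to sets `U` of primes `≤ x` with `∏ U ≤ Q` (`Q ≤ x`), via
`q ↦ primeFactors q`, `U ↦ ∏ U`. [folklore] -/
theorem sum_squarefree_Icc_eq_sum_powerset {Q x : ℕ} (hQx : Q ≤ x) (F : Finset ℕ → ℝ) :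
    ∑ q ∈ (Finset.Icc 1 Q).filter Squarefree, F q.primeFactors =
      ∑ U ∈ (Nat.primesLE x).powerset.filter (fun U => ∏ p ∈ U, p ≤ Q), F U := by
  refine Finset.sum_nbij' (fun q => q.primeFactors) (fun U => ∏ p ∈ U, p) ?_ ?_ ?_ ?_ (fun q _ => rfl)
  · intro q hq
    rw [Finset.mem_filter, Finset.mem_Icc] at hq
    obtain ⟨⟨-, hqQ⟩, hsq⟩ := hq
    rw [Finset.mem_filter, Finset.mem_powerset]
    refine ⟨fun p hp => Nat.mem_primesLE.mpr ?_, ?_⟩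
    · exact ⟨(Nat.le_of_mem_primeFactors hp).trans (hqQ.trans hQx), Nat.prime_of_mem_primeFactors hp⟩
    · rw [Nat.prod_primeFactors_of_squarefree hsq]
      exact hqQ
  · intro U hU
    rw [Finset.mem_filter, Finset.mem_powerset] at hU
    have hprime : ∀ p ∈ U, p.Prime := fun p hp => Nat.prime_of_mem_primesLE (hU.1 hp)
    rw [Finset.mem_filter, Finset.mem_Icc]
    refine ⟨⟨Nat.one_le_iff_ne_zero.mpr (Finset.prod_ne_zero_iff.mpr fun p hp => (hprime p hp).ne_zero), hU.2⟩,
      Finset.squarefree_prod_of_pairwise_isCoprime (fun p hp q hq hpq => ?_) fun p hp => (hprime p hp).squarefree⟩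
    exact Nat.coprime_iff_isRelPrime.1 ((Nat.coprime_primes (hprime p hp) (hprime q hq)).2 hpq)
  · intro q hq
    exact Nat.prod_primeFactors_of_squarefree (Finset.mem_filter.mp hq).2
  · intro U hU
    rw [Finset.mem_filter, Finset.mem_powerset] at hU
    exact Nat.primeFactors_prod fun p hp => Nat.prime_of_mem_primesLE (hU.1 hp)

/-- **EULER EXPANSION WITH TAIL**: for `Q ≤ x`,
`∏_{p ≤ x} β_p - Σ_{q ≤ Q sqfree} ∏_{p ∣ q} (β_p - 1) = Σ_{U ⊆ {p ≤ x}, ∏ U > Q} ∏_{p ∈ U} (β_p - 1)`.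
[cite: Gallagher1976, Section 2] -/
theorem singularProductPartial_sub_sum_squarefree {d s : ℕ} (Ψ : Fin s → AffLinForm d) {Q x : ℕ} (hQx : Q ≤ x) :
    singularProductPartial Ψ x -
        ∑ q ∈ (Finset.Icc 1 Q).filter Squarefree, ∏ p ∈ q.primeFactors, (localFactor Ψ p - 1) =
      ∑ U ∈ (Nat.primesLE x).powerset.filter (fun U => ¬(∏ p ∈ U, p ≤ Q)),
        ∏ p ∈ U, (localFactor Ψ p - 1) := by
  have h1 := sum_squarefree_Icc_eq_sum_powerset hQx (fun U => ∏ p ∈ U, (localFactor Ψ p - 1))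
  beta_reduce at h1
  rw [singularProductPartial_eq_sum_powerset, h1,
    ← Finset.sum_filter_add_sum_filter_not (Nat.primesLE x).powerset (fun U => ∏ p ∈ U, p ≤ Q)]
  ring

/-- The same for a system given by coefficient and shift vectors, with the band sum of the spectrum:
`∏_{p ≤ x} β_p(sys a b) - bandSum Q g a b = Σ_{U ⊆ {p ≤ x}, ∏ U > Q} ∏_{p ∈ U} (β_p - 1)` (`Q ≤ x`).
[cite: Gallagher1976, Section 2] -/
theorem singularProductPartial_sub_bandSum {g : ℕ → (Fin t → ℤ) → IncType t → ℝ}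
    (hg : ∀ (q : ℕ) (a b : Fin t → ℤ),
      g q a (incType q a b) = if Squarefree q then ∏ p ∈ q.primeFactors, (localFactor (sys a b) p - 1) else 0)
    (a b : Fin t → ℤ) {Q x : ℕ} (hQx : Q ≤ x) :
    singularProductPartial (sys a b) x - bandSum Q g a b =
      ∑ U ∈ (Nat.primesLE x).powerset.filter (fun U => ¬(∏ p ∈ U, p ≤ Q)),
        ∏ p ∈ U, (localFactor (sys a b) p - 1) := by
  rw [bandSum_eq_sum_squarefree hg]
  exact singularProductPartial_sub_sum_squarefree (sys a b) hQx

end EulerExpansion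

end Summit.Parity.GeneralizedHardyLittlewood.Cruxes.RelativeDimOne.GallagherBackwardsSplit

end
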